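import Literature.NumberTheory.Sieve.RosserSieveHalfLemma18
import HarnessLib

/-!
# Rosser's sieve: the majorant package for the main-term induction (`κ > 1/2`)

Topic `Literature/NumberTheory/Sieve`; Iwaniec, *Rosser's sieve*, Acta Arith. 36 (1980), §§6–8. In the
proof of Lemma 20 the error term of the inductive bound (8.1) is carried by the functions
`G^±_z(s) = C e^{√K} (1 + s^{50}/log y)^s q^±(s)` built from the majorants `q^± = s^{κ+1} Q^±` of §6
(Lemmas 13, 17), which absorb the loss `(log(y/p))^{−1/3} = (log y)^{−1/3} (1 − 1/t)^{−1/3}` of each step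
through the comparison (7.4)–(7.5) of the kernel `k(t) = κ (1 − 1/t)^{−κ}/t` of (7.3) with the majorant
kernel `κ t^κ (t − 1)^{−κ−1} = k(t) · t/(t − 1)`. This file PROVES, for the greatest `β`-sieve data of
dimension `κ > 1/2` (`β = β_κ > 1`), the analytic inputs that our version of the induction
(`RosserSieveInduction.lean`, exponent `e ≤ 1/3`, error majorant `H^± = C₁ q^± + e^{−s}` in place of
Iwaniec's `G^±`) consumes, packaged as `exists_majorant_package`:

* kernel comparisons: `k(t)(1 − 1/t)^{−e} = κ(1 − 1/t)^{−κ−e}/t ≤ κ t^κ (t − 1)^{−κ−1}` (`e ≤ 1`) and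
  `≤ κ(1 − 1/β)^{−κ−e}/s` for `t ≥ s ≥ β`;
* `q^±` are positive, continuous and non-increasing on `ℝ` (from (6.2) integrated,
  `RosserSieveMajorants`, and positivity, `RosserSieveLemma14`);
* the finite-range forms of (7.4)–(7.5): `∫_s^U k_e(t) q⁺(t − 1) dt ≤ q⁻(s)` (`s ≥ β`),
  `∫_s^U k_e q⁻(t − 1) ≤ q⁺(s)` (`s ≥ β + 1`), and `∫_s^U k_e e^{−(t−1)} ≤ (eκ(1 − 1/β)^{−κ−e}/s) e^{−s}`;
* `exists_majorant_package`: for every `ε₁ > 0` functions `H^±` with `H^± > 0`, non-increasing, continuous,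
  `∫_s^U k_e H⁺(· − 1) ≤ (1 + ε₁) H⁻(s)`, `∫_s^U k_e H⁻(· − 1) ≤ (1 + ε₁) H⁺(s)`, one-step ratio bounds
  `H^±(s − 1) ≤ R H^∓(s)`, Lemma 17 in the form `T^±_N ≤ c₀ H^±` (`RosserSieveLemma14.lemma17`), and
  `e^{−s} ≤ H^±(s)` (the exponential floor lets Rankin's crude bound at the truncation level be absorbed,
  which `q^±` alone — decaying like `e^{−s log s}` — could not do).

Everything here is PROVED; no new definitions.

## References

* H. Iwaniec, *Rosser's sieve*, Acta Arith. 36 (1980), 171–202: §6 (6.1)–(6.2), Lemma 13; §7 (7.3)–(7.6),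
  Lemma 17; §8, Lemma 20 and (8.1). [IwaniecActaArith1980]
* G. Greaves, *Sieves in Number Theory*, Springer (2001), §4.3.1 (Lemmas 1–2), §4.4.3 (Lemma 4).
  [Greaves2001]
-/

open Filter Set MeasureTheory intervalIntegral
open scoped Topology

noncomputable section

namespace Literature.NumberTheory.Sieve

namespace BetaSieve

open BetaSieveForward (sieveKernel sieveKernel_nonneg continuousOn_sieveKernel)
open RosserMajorant

variable {κ β : ℝ}

/-! ### The Lemma-20 kernel `k_e(t) = k(t) (1 − 1/t)^{−e}` against the majorant kernel `κ t^κ (t − 1)^{−κ−1}` -/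

/-- `k(t) (1 − 1/t)^{−e} = κ (1 − 1/t)^{−κ−e} / t` for `t > 1`. [folklore] -/
theorem sieveKernel_mul_rpow_eq {e t : ℝ} (ht : 1 < t) :
    sieveKernel κ t * (1 - 1 / t) ^ (-e) = κ * (1 - 1 / t) ^ (-κ - e) / t := by
  have ht0 : 0 < t := by linarith
  have hb : 0 < 1 - 1 / t := by
    rw [sub_pos, div_lt_one ht0]; exact ht
  rw [sieveKernel_eq_of_one_lt ht, show (-κ - e : ℝ) = -κ + -e by ring, Real.rpow_add hb]
  ring

/-- `k(t) (1 − 1/t)^{−e} ≤ κ t^κ (t − 1)^{−κ−1}` for `t > 1`, `e ≤ 1`, `κ ≥ 0` (the ratio is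
`(1 − 1/t)^{1−e} ≤ 1`). [folklore] -/
theorem sieveKernel_mul_rpow_le_integrand (hκ : 0 ≤ κ) {e t : ℝ} (he : e ≤ 1) (ht : 1 < t) :
    sieveKernel κ t * (1 - 1 / t) ^ (-e) ≤ κ * t ^ κ * (t - 1) ^ (-κ - 1) := by
  have ht0 : 0 < t := by linarith
  have hb : 0 < 1 - 1 / t := by
    rw [sub_pos, div_lt_one ht0]; exact ht
  have hb1 : 1 - 1 / t ≤ 1 := by
    have : 0 < 1 / t := by positivity
    linarith
  -- `κ t^κ (t-1)^{-κ-1} = κ (1 - 1/t)^{-κ-1} / t`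
  have hK : κ * t ^ κ * (t - 1) ^ (-κ - 1) = κ * (1 - 1 / t) ^ (-κ - 1) / t := by
    have e1 : 1 - 1 / t = (t - 1) / t := by field_simp
    rw [e1, Real.div_rpow (by linarith) ht0.le, Real.rpow_sub ht0, Real.rpow_neg ht0.le,
      Real.rpow_one]
    have : t ^ κ ≠ 0 := (Real.rpow_pos_of_pos ht0 κ).ne'
    field_simp
  rw [sieveKernel_mul_rpow_eq ht, hK]
  refine div_le_div_of_nonneg_right (mul_le_mul_of_nonneg_left ?_ hκ) ht0.le
  exact Real.rpow_le_rpow_of_exponent_ge hb hb1 (by linarith)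

/-- `k(t) (1 − 1/t)^{−e} ≤ κ (1 − 1/β)^{−κ−e} / s` for `t ≥ s ≥ β > 1`, `κ ≥ 0`, `κ + e ≥ 0`. [folklore] -/
theorem sieveKernel_mul_rpow_le_div (hκ : 0 ≤ κ) (hβ : 1 < β) {e s t : ℝ} (hκe : 0 ≤ κ + e)
    (hs : β ≤ s) (hst : s ≤ t) :
    sieveKernel κ t * (1 - 1 / t) ^ (-e) ≤ κ * (1 - 1 / β) ^ (-κ - e) / s := by
  have ht : 1 < t := by linarith
  have ht0 : 0 < t := by linarith
  have hβ0 : 0 < β := by linarith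
  have hbβ : 0 < 1 - 1 / β := by rw [sub_pos, div_lt_one hβ0]; exact hβ
  have hbt : 1 - 1 / β ≤ 1 - 1 / t := by
    have : 1 / t ≤ 1 / β := one_div_le_one_div_of_le hβ0 (by linarith)
    linarith
  rw [sieveKernel_mul_rpow_eq ht]
  have h1 : (1 - 1 / t) ^ (-κ - e) ≤ (1 - 1 / β) ^ (-κ - e) :=
    Real.rpow_le_rpow_of_nonpos hbβ hbt (by linarith)
  have h2 : 0 ≤ κ * (1 - 1 / β) ^ (-κ - e) := mul_nonneg hκ (Real.rpow_nonneg hbβ.le _)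
  calc κ * (1 - 1 / t) ^ (-κ - e) / t ≤ κ * (1 - 1 / β) ^ (-κ - e) / t :=
        div_le_div_of_nonneg_right (mul_le_mul_of_nonneg_left h1 hκ) ht0.le
    _ ≤ κ * (1 - 1 / β) ^ (-κ - e) / s := div_le_div_of_nonneg_left h2 (by linarith) hst

/-- Continuity of `t ↦ k(t) (1 − 1/t)^{−e}` on `(1, ∞)`. [folklore] -/
theorem continuousOn_sieveKernel_mul_rpow (κ e : ℝ) :
    ContinuousOn (fun t : ℝ => sieveKernel κ t * (1 - 1 / t) ^ (-e)) (Ioi 1) := by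
  refine (continuousOn_sieveKernel κ).mul fun t ht => ?_
  have ht1 : (1:ℝ) < t := ht
  have ht0 : (0:ℝ) < t := by linarith
  have hb : (0:ℝ) < 1 - 1 / t := by rw [sub_pos, div_lt_one ht0]; exact ht1
  have hc : ContinuousAt (fun x : ℝ => 1 - 1 / x) t :=
    continuousAt_const.sub (continuousAt_const.div continuousAt_id ht0.ne')
  exact (hc.rpow_const (Or.inl hb.ne')).continuousWithinAt

/-! ### Monotonicity and continuity of the majorants `q^±` on `ℝ` -/

/-- **`q⁻` is non-increasing on `ℝ`** (constant on `(−∞, β]`, with nonnegative derivative loss beyond: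
(6.2) integrated, `qLower_sub_eq_integral`, and `q⁺ > 0`). [cite: IwaniecActaArith1980, §6 (6.2)] -/
theorem qLower_antitone (hκ : 0 ≤ κ) (hβ : 1 < β) (hposU : ∀ u : ℝ, 0 < qUpper κ β u) :
    Antitone (qLower κ β) := by
  have hstep : ∀ a b, β ≤ a → a ≤ b → qLower κ β b ≤ qLower κ β a := by
    intro a b ha hab
    have h := qLower_sub_eq_integral (κ := κ) hβ ha hab
    have h0 : 0 ≤ ∫ t in a..b, κ * t ^ κ * (t - 1) ^ (-κ - 1) * qUpper κ β (t - 1) :=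
      intervalIntegral.integral_nonneg hab fun t ht => by
        have ht1 : 1 < t := by linarith [ht.1]
        have := Real.rpow_nonneg (by linarith : (0:ℝ) ≤ t) κ
        have := Real.rpow_nonneg (by linarith : (0:ℝ) ≤ t - 1) (-κ - 1)
        have := (hposU (t - 1)).le
        positivity
    linarith
  intro a b hab
  rcases le_or_gt b β with hb | hb
  · rw [qLower_eq hb, qLower_eq (hab.trans hb)]
  · rcases le_or_gt a β with ha | ha
    · rw [qLower_eq ha, ← qLower_eq (le_refl β)]
      exact hstep β b le_rfl hb.le
    · exact hstep a b ha.le hab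

/-- **`q⁺` is non-increasing on `ℝ`**. [cite: IwaniecActaArith1980, §6 (6.2)] -/
theorem qUpper_antitone (hκ : 0 ≤ κ) (hβ : 1 < β) (hposL : ∀ u : ℝ, 0 < qLower κ β u) :
    Antitone (qUpper κ β) := by
  have hstep : ∀ a b, β + 1 ≤ a → a ≤ b → qUpper κ β b ≤ qUpper κ β a := by
    intro a b ha hab
    have h := qUpper_sub_eq_integral (κ := κ) hβ ha hab
    have h0 : 0 ≤ ∫ t in a..b, κ * t ^ κ * (t - 1) ^ (-κ - 1) * qLower κ β (t - 1) :=
      intervalIntegral.integral_nonneg hab fun t ht => by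
        have ht1 : 1 < t := by linarith [ht.1]
        have := Real.rpow_nonneg (by linarith : (0:ℝ) ≤ t) κ
        have := Real.rpow_nonneg (by linarith : (0:ℝ) ≤ t - 1) (-κ - 1)
        have := (hposL (t - 1)).le
        positivity
    linarith
  intro a b hab
  rcases le_or_gt b (β + 1) with hb | hb
  · rw [qUpper_eq hb, qUpper_eq (hab.trans hb)]
  · rcases le_or_gt a (β + 1) with ha | ha
    · rw [qUpper_eq ha, ← qUpper_eq (le_refl (β + 1))]
      exact hstep (β + 1) b le_rfl hb.le
    · exact hstep a b ha.le hab

/-- `q⁻` is continuous on `ℝ` (`β > 1`). [folklore] -/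
theorem continuous_qLower (hβ : 1 < β) : Continuous (qLower κ β) := by
  refine continuous_iff_continuousAt.mpr fun s => ?_
  rcases lt_or_ge s β with h | h
  · refine (continuousAt_const (y := (β - 1) ^ (-κ))).congr ?_
    filter_upwards [Iio_mem_nhds h] with t ht
    exact (qLower_eq (le_of_lt ht)).symm
  · exact (continuousOn_qLower hβ).continuousAt (Ioi_mem_nhds (by linarith : (0:ℝ) < s))

/-- `q⁺` is continuous on `ℝ` (`β > 1`). [folklore] -/
theorem continuous_qUpper (hβ : 1 < β) : Continuous (qUpper κ β) := by
  refine continuous_iff_continuousAt.mpr fun s => ?_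
  rcases lt_or_ge s (β + 1) with h | h
  · refine (continuousAt_const (y := β ^ (-κ))).congr ?_
    filter_upwards [Iio_mem_nhds h] with t ht
    exact (qUpper_eq (le_of_lt ht)).symm
  · exact (continuousOn_qUpper hβ).continuousAt (Ioi_mem_nhds (by linarith : (0:ℝ) < s))

/-- Positivity of `q^±` on all of `ℝ` from positivity on `(0, ∞)` (the values on `(−∞, 0]` are the
initial constants). [folklore] -/
theorem qUpper_pos_qLower_pos_real (hβ : 1 < β) (hpos : ∀ u : ℝ, 0 < u → 0 < qUpper κ β u ∧ 0 < qLower κ β u)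
    (u : ℝ) : 0 < qUpper κ β u ∧ 0 < qLower κ β u := by
  rcases le_or_gt u 0 with h | h
  · rw [qUpper_eq (by linarith), qLower_eq (by linarith)]
    exact ⟨Real.rpow_pos_of_pos (by linarith) _, Real.rpow_pos_of_pos (by linarith) _⟩
  · exact hpos u h

/-! ### The three basic integral bounds for the Lemma-20 kernel -/

/-- **`∫_s^U k_e(t) q⁺(t − 1) dt ≤ q⁻(s)`** for `β ≤ s ≤ U` (kernel comparison and (6.2) integrated;
no limit is needed). [cite: IwaniecActaArith1980, §7 (7.4)–(7.5)] -/
theorem integral_kernel_qUpper_le (hκ : 0 ≤ κ) (hβ : 1 < β) {e : ℝ} (he : e ≤ 1)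
    (hpos : ∀ u : ℝ, 0 < qUpper κ β u ∧ 0 < qLower κ β u) {s U : ℝ} (hs : β ≤ s) (hsU : s ≤ U) :
    ∫ t in s..U, sieveKernel κ t * (1 - 1 / t) ^ (-e) * qUpper κ β (t - 1) ≤ qLower κ β s := by
  have hs1 : 1 < s := by linarith
  have hcont1 : ContinuousOn (fun t => sieveKernel κ t * (1 - 1 / t) ^ (-e) * qUpper κ β (t - 1))
      (Icc s U) :=
    ((continuousOn_sieveKernel_mul_rpow κ e).mono fun t ht => show (1:ℝ) < t by linarith [ht.1]).mul
      ((continuous_qUpper hβ).comp (continuous_id.sub continuous_const)).continuousOn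
  have hcont2 : ContinuousOn (fun t => κ * t ^ κ * (t - 1) ^ (-κ - 1) * qUpper κ β (t - 1)) (Icc s U) :=
    (continuousOn_integrand_qUpper (κ := κ) hβ).mono fun t ht => show (1:ℝ) < t by linarith [ht.1]
  have hmono : ∫ t in s..U, sieveKernel κ t * (1 - 1 / t) ^ (-e) * qUpper κ β (t - 1) ≤
      ∫ t in s..U, κ * t ^ κ * (t - 1) ^ (-κ - 1) * qUpper κ β (t - 1) := by
    refine intervalIntegral.integral_mono_on hsU ?_ ?_ fun t ht => ?_
    · exact (hcont1.mono (by rw [uIcc_of_le hsU])).intervalIntegrable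
    · exact (hcont2.mono (by rw [uIcc_of_le hsU])).intervalIntegrable
    · exact mul_le_mul_of_nonneg_right (sieveKernel_mul_rpow_le_integrand hκ he (by linarith [ht.1]))
        (hpos _).1.le
  rw [← qLower_sub_eq_integral hβ hs hsU] at hmono
  linarith [(hpos U).2]

/-- **`∫_s^U k_e(t) q⁻(t − 1) dt ≤ q⁺(s)`** for `β + 1 ≤ s ≤ U`. [cite: IwaniecActaArith1980, §7 (7.4)–(7.5)] -/
theorem integral_kernel_qLower_le (hκ : 0 ≤ κ) (hβ : 1 < β) {e : ℝ} (he : e ≤ 1)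
    (hpos : ∀ u : ℝ, 0 < qUpper κ β u ∧ 0 < qLower κ β u) {s U : ℝ} (hs : β + 1 ≤ s) (hsU : s ≤ U) :
    ∫ t in s..U, sieveKernel κ t * (1 - 1 / t) ^ (-e) * qLower κ β (t - 1) ≤ qUpper κ β s := by
  have hs1 : 1 < s := by linarith
  have hcont1 : ContinuousOn (fun t => sieveKernel κ t * (1 - 1 / t) ^ (-e) * qLower κ β (t - 1))
      (Icc s U) :=
    ((continuousOn_sieveKernel_mul_rpow κ e).mono fun t ht => show (1:ℝ) < t by linarith [ht.1]).mul
      ((continuous_qLower hβ).comp (continuous_id.sub continuous_const)).continuousOn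
  have hcont2 : ContinuousOn (fun t => κ * t ^ κ * (t - 1) ^ (-κ - 1) * qLower κ β (t - 1)) (Icc s U) :=
    (continuousOn_integrand_qLower (κ := κ) hβ).mono fun t ht => show (1:ℝ) < t by linarith [ht.1]
  have hmono : ∫ t in s..U, sieveKernel κ t * (1 - 1 / t) ^ (-e) * qLower κ β (t - 1) ≤
      ∫ t in s..U, κ * t ^ κ * (t - 1) ^ (-κ - 1) * qLower κ β (t - 1) := by
    refine intervalIntegral.integral_mono_on hsU ?_ ?_ fun t ht => ?_
    · exact (hcont1.mono (by rw [uIcc_of_le hsU])).intervalIntegrable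
    · exact (hcont2.mono (by rw [uIcc_of_le hsU])).intervalIntegrable
    · exact mul_le_mul_of_nonneg_right (sieveKernel_mul_rpow_le_integrand hκ he (by linarith [ht.1]))
        (hpos _).2.le
  rw [← qUpper_sub_eq_integral hβ hs hsU] at hmono
  linarith [(hpos U).1]

/-- **`∫_s^U k_e(t) e^{−(t−1)} dt ≤ (κ (1 − 1/β)^{−κ−e} / s) · e · e^{−s}`** for `β ≤ s ≤ U`
(`k_e(t) ≤ κ (1 − 1/β)^{−κ−e}/s` and `∫_s^U e^{1−t} dt ≤ e^{1−s}`). [folklore] -/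
theorem integral_kernel_exp_le (hκ : 0 ≤ κ) (hβ : 1 < β) {e : ℝ} (hκe : 0 ≤ κ + e) {s U : ℝ}
    (hs : β ≤ s) (hsU : s ≤ U) :
    ∫ t in s..U, sieveKernel κ t * (1 - 1 / t) ^ (-e) * Real.exp (-(t - 1)) ≤
      κ * (1 - 1 / β) ^ (-κ - e) / s * (Real.exp 1 * Real.exp (-s)) := by
  set b := κ * (1 - 1 / β) ^ (-κ - e) / s with hb
  have hs0 : 0 < s := by linarith
  have hβ0 : 0 < β := by linarith
  have hbβ : 0 < 1 - 1 / β := by rw [sub_pos, div_lt_one hβ0]; exact hβ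
  have hb0 : 0 ≤ b := div_nonneg (mul_nonneg hκ (Real.rpow_nonneg hbβ.le _)) hs0.le
  have hcont1 : ContinuousOn (fun t => sieveKernel κ t * (1 - 1 / t) ^ (-e) * Real.exp (-(t - 1)))
      (Icc s U) :=
    ((continuousOn_sieveKernel_mul_rpow κ e).mono fun t ht => show (1:ℝ) < t by linarith [ht.1]).mul
      (Real.continuous_exp.comp (continuous_id.sub continuous_const).neg).continuousOn
  have hmono : ∫ t in s..U, sieveKernel κ t * (1 - 1 / t) ^ (-e) * Real.exp (-(t - 1)) ≤
      ∫ t in s..U, b * Real.exp (-(t - 1)) := by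
    refine intervalIntegral.integral_mono_on hsU ?_ ?_ fun t ht => ?_
    · exact (hcont1.mono (by rw [uIcc_of_le hsU])).intervalIntegrable
    · exact (continuous_const.mul (Real.continuous_exp.comp
        (continuous_id.sub continuous_const).neg)).intervalIntegrable _ _
    · exact mul_le_mul_of_nonneg_right (sieveKernel_mul_rpow_le_div hκ hβ hκe hs ht.1)
        (Real.exp_pos _).le
  have h1 : ∀ t : ℝ, Real.exp (-(t - 1)) = Real.exp 1 * Real.exp (-t) := fun t => by
    rw [← Real.exp_add]; ring_nf
  have hI : ∫ t in s..U, b * Real.exp (-(t - 1)) = b * (Real.exp 1 * (Real.exp (-s) - Real.exp (-U))) := by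
    simp_rw [h1]
    rw [intervalIntegral.integral_const_mul, intervalIntegral.integral_const_mul,
      intervalIntegral.integral_comp_neg (fun x => Real.exp x), integral_exp]
  rw [hI] at hmono
  have h3 : 0 < Real.exp (-U) := Real.exp_pos _
  have h4 : 0 < Real.exp 1 := Real.exp_pos _
  calc ∫ t in s..U, sieveKernel κ t * (1 - 1 / t) ^ (-e) * Real.exp (-(t - 1))
      ≤ b * (Real.exp 1 * (Real.exp (-s) - Real.exp (-U))) := hmono
    _ ≤ b * (Real.exp 1 * Real.exp (-s)) := by nlinarith [mul_pos h4 h3]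

/-! ### The majorant package for `κ > 1/2`: `H^± = C₁ q^± + e^{−s}` -/

set_option maxHeartbeats 400000 in
/-- **The majorant package for `κ > 1/2`.** For the greatest `β`-sieve data of dimension `κ > 1/2`
(`β = β_κ > 1`), a loss exponent `0 ≤ e ≤ 1` and any `ε₁ > 0` there are functions `H⁺, H⁻` (namely
`C₁ q^± + e^{−s}` with Iwaniec's majorants `q^± = qUpper/qLower κ β` of §6 and a large constant `C₁`)
and constants `R, c₀` such that: `H^± > 0`, non-increasing and continuous on `ℝ`; the Lemma-20 kernel
`k_e(t) = k(t)(1 − 1/t)^{−e}` satisfies `∫_s^U k_e H⁺(· − 1) ≤ (1 + ε₁) H⁻(s)` (`s ≥ β`) and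
`∫_s^U k_e H⁻(· − 1) ≤ (1 + ε₁) H⁺(s)` (`s ≥ β + 1`) ((7.4)–(7.5) with the comparison
`k_e ≤ κ t^κ (t − 1)^{−κ−1}`); the one-step ratios `H⁺(s − 1) ≤ R H⁻(s)`, `H⁻(s − 1) ≤ R H⁺(s)`;
Lemma 17 in the form `T⁻_N ≤ c₀ H⁻`, `T⁺_N ≤ c₀ H⁺`; and `e^{−s} ≤ H^±(s)`. These are the analytic inputs
of the main-term induction (`RosserSieveInduction`). [cite: IwaniecActaArith1980, Lemmas 13, 17 and (7.4)–(7.6)] -/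
theorem exists_majorant_package (hκ : 1 / 2 < κ) {B : (ℝ → ℝ) × (ℝ → ℝ) × ℝ × ℝ}
    (hB : IsGreatestBetaSieveData κ B) {e : ℝ} (he0 : 0 ≤ e) (he1 : e ≤ 1) {ε₁ : ℝ} (hε₁ : 0 < ε₁) :
    ∃ (Hp Hm : ℝ → ℝ) (R c₀ : ℝ),
      (∀ s, 0 < Hp s ∧ 0 < Hm s) ∧ Antitone Hp ∧ Antitone Hm ∧ Continuous Hp ∧ Continuous Hm ∧
      (∀ s U : ℝ, B.2.2.1 ≤ s → s ≤ U →
        ∫ t in s..U, sieveKernel κ t * (1 - 1 / t) ^ (-e) * Hp (t - 1) ≤ (1 + ε₁) * Hm s) ∧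
      (∀ s U : ℝ, B.2.2.1 + 1 ≤ s → s ≤ U →
        ∫ t in s..U, sieveKernel κ t * (1 - 1 / t) ^ (-e) * Hm (t - 1) ≤ (1 + ε₁) * Hp s) ∧
      (∀ s, B.2.2.1 ≤ s → Hp (s - 1) ≤ R * Hm s) ∧ (∀ s, B.2.2.1 + 1 ≤ s → Hm (s - 1) ≤ R * Hp s) ∧
      (∀ (N : ℕ) (u : ℝ), (B.2.2.1 ≤ u → contT 0 κ B.2.2.1 N u ≤ c₀ * Hm u) ∧
        (B.2.2.1 - 1 ≤ u → contT 1 κ B.2.2.1 N u ≤ c₀ * Hp u)) ∧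
      (∀ s, Real.exp (-s) ≤ Hp s ∧ Real.exp (-s) ≤ Hm s) := by
  set β := B.2.2.1 with hβdef
  have hm := majorantHyp_of_greatest hκ hB
  have hβ : 1 < β := hm.one_lt
  have hκ0 : 0 < κ := by linarith
  have hβ0 : 0 < β := by linarith
  have hpos : ∀ u : ℝ, 0 < qUpper κ β u ∧ 0 < qLower κ β u := qUpper_pos_qLower_pos_real hβ hm.pos
  obtain ⟨c, hc, hbd⟩ := lemma17 hκ hB
  -- constants
  have hbβ : 0 < 1 - 1 / β := by rw [sub_pos, div_lt_one hβ0]; exact hβ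
  set b : ℝ := κ * (1 - 1 / β) ^ (-κ - e) with hb
  have hb0 : 0 ≤ b := mul_nonneg hκ0.le (Real.rpow_nonneg hbβ.le _)
  set sh : ℝ := max (β + 1) (b * Real.exp 1 / ε₁) with hsh
  have hshβ : β + 1 ≤ sh := le_max_left _ _
  have hsh0 : 0 < sh := by linarith
  set qm : ℝ := min (qLower κ β sh) (qUpper κ β sh) with hqm
  have hqm0 : 0 < qm := lt_min (hpos sh).2 (hpos sh).1
  set C₁ : ℝ := max 1 (b * Real.exp 1 / (β * ε₁ * qm)) with hC₁
  have hC₁1 : 1 ≤ C₁ := le_max_left _ _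
  have hC₁0 : 0 < C₁ := by linarith
  -- the functions
  set Hp : ℝ → ℝ := fun s => C₁ * qUpper κ β s + Real.exp (-s) with hHp
  set Hm : ℝ → ℝ := fun s => C₁ * qLower κ β s + Real.exp (-s) with hHm
  have hHpos : ∀ s, 0 < Hp s ∧ 0 < Hm s := fun s =>
    ⟨add_pos (mul_pos hC₁0 (hpos s).1) (Real.exp_pos _), add_pos (mul_pos hC₁0 (hpos s).2) (Real.exp_pos _)⟩
  have hexp_anti : Antitone fun s : ℝ => Real.exp (-s) := fun a b hab =>
    Real.exp_le_exp.mpr (neg_le_neg hab)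
  have hHp_anti : Antitone Hp := fun a b hab => add_le_add
    (mul_le_mul_of_nonneg_left (qUpper_antitone hκ0.le hβ (fun u => (hpos u).2) hab) hC₁0.le)
    (hexp_anti hab)
  have hHm_anti : Antitone Hm := fun a b hab => add_le_add
    (mul_le_mul_of_nonneg_left (qLower_antitone hκ0.le hβ (fun u => (hpos u).1) hab) hC₁0.le)
    (hexp_anti hab)
  have hexp_cont : Continuous fun s : ℝ => Real.exp (-s) := Real.continuous_exp.comp continuous_neg
  have hHp_cont : Continuous Hp := (continuous_const.mul (continuous_qUpper hβ)).add hexp_cont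
  have hHm_cont : Continuous Hm := (continuous_const.mul (continuous_qLower hβ)).add hexp_cont
  -- decay thresholds for the ratio bounds
  obtain ⟨u₁, hu₁⟩ := eventually_atTop.mp (hm.eventually_qUpper_le 3)
  obtain ⟨u₂, hu₂⟩ := eventually_atTop.mp (hm.eventually_qLower_le 3)
  set s₁ : ℝ := max (max u₁ u₂ + 1) (β + 2) with hs₁
  set R : ℝ := max (C₁ + Real.exp 1) (max (Hp (β - 1) / Hm s₁) (Hm β / Hp s₁)) with hR
  refine ⟨Hp, Hm, R, c, hHpos, hHp_anti, hHm_anti, hHp_cont, hHm_cont, ?_, ?_, ?_, ?_, ?_, ?_⟩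
  · -- (H1)
    intro s U hs hsU
    have hs0 : 0 < s := by linarith
    have hI1 := integral_kernel_qUpper_le hκ0.le hβ he1 hpos hs hsU
    have hI2 := integral_kernel_exp_le hκ0.le hβ (e := e) (by linarith) hs hsU
    have hsplit : ∫ t in s..U, sieveKernel κ t * (1 - 1 / t) ^ (-e) * Hp (t - 1) =
        C₁ * (∫ t in s..U, sieveKernel κ t * (1 - 1 / t) ^ (-e) * qUpper κ β (t - 1)) +
          ∫ t in s..U, sieveKernel κ t * (1 - 1 / t) ^ (-e) * Real.exp (-(t - 1)) := by
      have hc1 : ContinuousOn (fun t => sieveKernel κ t * (1 - 1 / t) ^ (-e)) (uIcc s U) := by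
        rw [uIcc_of_le hsU]
        exact (continuousOn_sieveKernel_mul_rpow κ e).mono fun t ht => show (1:ℝ) < t by linarith [ht.1]
      have hi1 : IntervalIntegrable (fun t => sieveKernel κ t * (1 - 1 / t) ^ (-e) * qUpper κ β (t - 1))
          volume s U :=
        (hc1.mul ((continuous_qUpper hβ).comp (continuous_id.sub continuous_const)).continuousOn).intervalIntegrable
      have hi2 : IntervalIntegrable (fun t => sieveKernel κ t * (1 - 1 / t) ^ (-e) * Real.exp (-(t - 1)))
          volume s U :=
        (hc1.mul (Real.continuous_exp.comp (continuous_id.sub continuous_const).neg).continuousOn).intervalIntegrable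
      rw [← intervalIntegral.integral_const_mul, ← intervalIntegral.integral_add (hi1.const_mul C₁) hi2]
      refine intervalIntegral.integral_congr fun t _ => ?_
      simp only [hHp]; ring
    rw [hsplit]
    have hq0 := (hpos s).2
    rcases le_or_gt sh s with hcase | hcase
    · -- `s ≥ sh`: `b e / s ≤ ε₁`
      have h1 : b / s * (Real.exp 1 * Real.exp (-s)) ≤ ε₁ * Real.exp (-s) := by
        have hle : b * Real.exp 1 / ε₁ ≤ s := (le_max_right _ _).trans hcase
        rw [div_le_iff₀ hε₁] at hle
        have : b / s * Real.exp 1 ≤ ε₁ := by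
          rw [div_mul_eq_mul_div, div_le_iff₀ hs0]; linarith
        calc b / s * (Real.exp 1 * Real.exp (-s)) = (b / s * Real.exp 1) * Real.exp (-s) := by ring
          _ ≤ ε₁ * Real.exp (-s) := mul_le_mul_of_nonneg_right this (Real.exp_pos _).le
      calc C₁ * (∫ t in s..U, sieveKernel κ t * (1 - 1 / t) ^ (-e) * qUpper κ β (t - 1)) +
            ∫ t in s..U, sieveKernel κ t * (1 - 1 / t) ^ (-e) * Real.exp (-(t - 1))
          ≤ C₁ * qLower κ β s + ε₁ * Real.exp (-s) := add_le_add (mul_le_mul_of_nonneg_left hI1 hC₁0.le) (hI2.trans h1)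
        _ ≤ (1 + ε₁) * Hm s := by
            simp only [hHm]
            have : 0 ≤ C₁ * qLower κ β s := by positivity
            have : 0 ≤ Real.exp (-s) := (Real.exp_pos _).le
            nlinarith
    · -- `β ≤ s < sh`: the exponential part is absorbed by `ε₁ C₁ q⁻(s)`
      have hqs : qm ≤ qLower κ β s :=
        (min_le_left _ _).trans (qLower_antitone hκ0.le hβ (fun u => (hpos u).1) hcase.le)
      have h1 : b / s * (Real.exp 1 * Real.exp (-s)) ≤ ε₁ * (C₁ * qLower κ β s) := by
        have hes : Real.exp (-s) ≤ 1 := by rw [Real.exp_le_one_iff]; linarith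
        have hC₁' : b * Real.exp 1 / (β * ε₁ * qm) ≤ C₁ := le_max_right _ _
        rw [div_le_iff₀ (by positivity)] at hC₁'
        have hbs : b / s ≤ b / β := div_le_div_of_nonneg_left hb0 hβ0 hs
        calc b / s * (Real.exp 1 * Real.exp (-s)) ≤ b / β * (Real.exp 1 * 1) := by
              gcongr
          _ = (b * Real.exp 1) / β := by ring
          _ ≤ C₁ * (β * ε₁ * qm) / β := div_le_div_of_nonneg_right hC₁' hβ0.le
          _ = ε₁ * (C₁ * qm) := by field_simp
          _ ≤ ε₁ * (C₁ * qLower κ β s) := by gcongr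
      calc C₁ * (∫ t in s..U, sieveKernel κ t * (1 - 1 / t) ^ (-e) * qUpper κ β (t - 1)) +
            ∫ t in s..U, sieveKernel κ t * (1 - 1 / t) ^ (-e) * Real.exp (-(t - 1))
          ≤ C₁ * qLower κ β s + ε₁ * (C₁ * qLower κ β s) :=
            add_le_add (mul_le_mul_of_nonneg_left hI1 hC₁0.le) (hI2.trans h1)
        _ ≤ (1 + ε₁) * Hm s := by
            simp only [hHm]
            have : 0 ≤ Real.exp (-s) := (Real.exp_pos _).le
            nlinarith
  · -- (H2)
    intro s U hs hsU
    have hs0 : 0 < s := by linarith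
    have hsβ : β ≤ s := by linarith
    have hI1 := integral_kernel_qLower_le hκ0.le hβ he1 hpos hs hsU
    have hI2 := integral_kernel_exp_le hκ0.le hβ (e := e) (by linarith) hsβ hsU
    have hsplit : ∫ t in s..U, sieveKernel κ t * (1 - 1 / t) ^ (-e) * Hm (t - 1) =
        C₁ * (∫ t in s..U, sieveKernel κ t * (1 - 1 / t) ^ (-e) * qLower κ β (t - 1)) +
          ∫ t in s..U, sieveKernel κ t * (1 - 1 / t) ^ (-e) * Real.exp (-(t - 1)) := by
      have hc1 : ContinuousOn (fun t => sieveKernel κ t * (1 - 1 / t) ^ (-e)) (uIcc s U) := by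
        rw [uIcc_of_le hsU]
        exact (continuousOn_sieveKernel_mul_rpow κ e).mono fun t ht => show (1:ℝ) < t by linarith [ht.1]
      have hi1 : IntervalIntegrable (fun t => sieveKernel κ t * (1 - 1 / t) ^ (-e) * qLower κ β (t - 1))
          volume s U :=
        (hc1.mul ((continuous_qLower hβ).comp (continuous_id.sub continuous_const)).continuousOn).intervalIntegrable
      have hi2 : IntervalIntegrable (fun t => sieveKernel κ t * (1 - 1 / t) ^ (-e) * Real.exp (-(t - 1)))
          volume s U :=
        (hc1.mul (Real.continuous_exp.comp (continuous_id.sub continuous_const).neg).continuousOn).intervalIntegrable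
      rw [← intervalIntegral.integral_const_mul, ← intervalIntegral.integral_add (hi1.const_mul C₁) hi2]
      refine intervalIntegral.integral_congr fun t _ => ?_
      simp only [hHm]; ring
    rw [hsplit]
    rcases le_or_gt sh s with hcase | hcase
    · have h1 : b / s * (Real.exp 1 * Real.exp (-s)) ≤ ε₁ * Real.exp (-s) := by
        have hle : b * Real.exp 1 / ε₁ ≤ s := (le_max_right _ _).trans hcase
        rw [div_le_iff₀ hε₁] at hle
        have : b / s * Real.exp 1 ≤ ε₁ := by
          rw [div_mul_eq_mul_div, div_le_iff₀ hs0]; linarith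
        calc b / s * (Real.exp 1 * Real.exp (-s)) = (b / s * Real.exp 1) * Real.exp (-s) := by ring
          _ ≤ ε₁ * Real.exp (-s) := mul_le_mul_of_nonneg_right this (Real.exp_pos _).le
      calc C₁ * (∫ t in s..U, sieveKernel κ t * (1 - 1 / t) ^ (-e) * qLower κ β (t - 1)) +
            ∫ t in s..U, sieveKernel κ t * (1 - 1 / t) ^ (-e) * Real.exp (-(t - 1))
          ≤ C₁ * qUpper κ β s + ε₁ * Real.exp (-s) := add_le_add (mul_le_mul_of_nonneg_left hI1 hC₁0.le) (hI2.trans h1)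
        _ ≤ (1 + ε₁) * Hp s := by
            simp only [hHp]
            have : 0 ≤ C₁ * qUpper κ β s := by have := (hpos s).1; positivity
            have : 0 ≤ Real.exp (-s) := (Real.exp_pos _).le
            nlinarith
    · have hqs : qm ≤ qUpper κ β s :=
        (min_le_right _ _).trans (qUpper_antitone hκ0.le hβ (fun u => (hpos u).2) hcase.le)
      have h1 : b / s * (Real.exp 1 * Real.exp (-s)) ≤ ε₁ * (C₁ * qUpper κ β s) := by
        have hes : Real.exp (-s) ≤ 1 := by rw [Real.exp_le_one_iff]; linarith
        have hC₁' : b * Real.exp 1 / (β * ε₁ * qm) ≤ C₁ := le_max_right _ _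
        rw [div_le_iff₀ (by positivity)] at hC₁'
        have hbs : b / s ≤ b / β := div_le_div_of_nonneg_left hb0 hβ0 hsβ
        calc b / s * (Real.exp 1 * Real.exp (-s)) ≤ b / β * (Real.exp 1 * 1) := by
              gcongr
          _ = (b * Real.exp 1) / β := by ring
          _ ≤ C₁ * (β * ε₁ * qm) / β := div_le_div_of_nonneg_right hC₁' hβ0.le
          _ = ε₁ * (C₁ * qm) := by field_simp
          _ ≤ ε₁ * (C₁ * qUpper κ β s) := by gcongr
      calc C₁ * (∫ t in s..U, sieveKernel κ t * (1 - 1 / t) ^ (-e) * qLower κ β (t - 1)) +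
            ∫ t in s..U, sieveKernel κ t * (1 - 1 / t) ^ (-e) * Real.exp (-(t - 1))
          ≤ C₁ * qUpper κ β s + ε₁ * (C₁ * qUpper κ β s) :=
            add_le_add (mul_le_mul_of_nonneg_left hI1 hC₁0.le) (hI2.trans h1)
        _ ≤ (1 + ε₁) * Hp s := by
            simp only [hHp]
            have : 0 ≤ Real.exp (-s) := (Real.exp_pos _).le
            nlinarith
  · -- ratio `H⁺(s-1) ≤ R H⁻(s)`, `s ≥ β`
    intro s hs
    have hHm0 := (hHpos s).2
    rcases le_or_gt s₁ s with hcase | hcase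
    · -- large `s`: `q⁺(s-1) ≤ e^{-3(s-1)} ≤ e^{-s}`
      have hs32 : 2 ≤ s := by
        have : β + 2 ≤ s₁ := le_max_right _ _
        linarith
      have hu : u₁ ≤ s - 1 := by
        have : max u₁ u₂ + 1 ≤ s₁ := le_max_left _ _
        have : u₁ ≤ max u₁ u₂ := le_max_left _ _
        linarith
      have hq : qUpper κ β (s - 1) ≤ Real.exp (-s) := by
        refine (hu₁ (s - 1) hu).trans (Real.exp_le_exp.mpr ?_)
        linarith
      calc Hp (s - 1) = C₁ * qUpper κ β (s - 1) + Real.exp 1 * Real.exp (-s) := by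
            simp only [hHp]; rw [← Real.exp_add]; ring_nf
        _ ≤ C₁ * Real.exp (-s) + Real.exp 1 * Real.exp (-s) := by gcongr
        _ = (C₁ + Real.exp 1) * Real.exp (-s) := by ring
        _ ≤ (C₁ + Real.exp 1) * Hm s := by
            refine mul_le_mul_of_nonneg_left ?_ (by positivity)
            simp only [hHm]; linarith [mul_pos hC₁0 (hpos s).2]
        _ ≤ R * Hm s := mul_le_mul_of_nonneg_right (le_max_left _ _) hHm0.le
    · -- `β ≤ s < s₁`: monotonicity
      have h1 : Hp (s - 1) ≤ Hp (β - 1) := hHp_anti (by linarith)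
      have h2 : Hm s₁ ≤ Hm s := hHm_anti hcase.le
      have hHm1 := (hHpos s₁).2
      calc Hp (s - 1) ≤ Hp (β - 1) := h1
        _ = (Hp (β - 1) / Hm s₁) * Hm s₁ := by field_simp
        _ ≤ (Hp (β - 1) / Hm s₁) * Hm s :=
            mul_le_mul_of_nonneg_left h2 (div_nonneg (hHpos _).1.le hHm1.le)
        _ ≤ R * Hm s :=
            mul_le_mul_of_nonneg_right ((le_max_left _ _).trans (le_max_right _ _)) hHm0.le
  · -- ratio `H⁻(s-1) ≤ R H⁺(s)`, `s ≥ β + 1`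
    intro s hs
    have hHp0 := (hHpos s).1
    rcases le_or_gt s₁ s with hcase | hcase
    · have hs32 : 2 ≤ s := by
        have : β + 2 ≤ s₁ := le_max_right _ _
        linarith
      have hu : u₂ ≤ s - 1 := by
        have : max u₁ u₂ + 1 ≤ s₁ := le_max_left _ _
        have : u₂ ≤ max u₁ u₂ := le_max_right _ _
        linarith
      have hq : qLower κ β (s - 1) ≤ Real.exp (-s) := by
        refine (hu₂ (s - 1) hu).trans (Real.exp_le_exp.mpr ?_)
        linarith
      calc Hm (s - 1) = C₁ * qLower κ β (s - 1) + Real.exp 1 * Real.exp (-s) := by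
            simp only [hHm]; rw [← Real.exp_add]; ring_nf
        _ ≤ C₁ * Real.exp (-s) + Real.exp 1 * Real.exp (-s) := by gcongr
        _ = (C₁ + Real.exp 1) * Real.exp (-s) := by ring
        _ ≤ (C₁ + Real.exp 1) * Hp s := by
            refine mul_le_mul_of_nonneg_left ?_ (by positivity)
            simp only [hHp]; linarith [mul_pos hC₁0 (hpos s).1]
        _ ≤ R * Hp s := mul_le_mul_of_nonneg_right (le_max_left _ _) hHp0.le
    · have h1 : Hm (s - 1) ≤ Hm β := hHm_anti (by linarith)
      have h2 : Hp s₁ ≤ Hp s := hHp_anti hcase.le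
      have hHp1 := (hHpos s₁).1
      calc Hm (s - 1) ≤ Hm β := h1
        _ = (Hm β / Hp s₁) * Hp s₁ := by field_simp
        _ ≤ (Hm β / Hp s₁) * Hp s :=
            mul_le_mul_of_nonneg_left h2 (div_nonneg (hHpos _).2.le hHp1.le)
        _ ≤ R * Hp s :=
            mul_le_mul_of_nonneg_right ((le_max_right _ _).trans (le_max_right _ _)) hHp0.le
  · -- Lemma 17
    intro N u
    constructor
    · intro hu
      have h := ((hbd N).1 u hu).le
      have : c * qLower κ β u ≤ c * Hm u := by
        refine mul_le_mul_of_nonneg_left ?_ hc.le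
        simp only [hHm]
        have := (hpos u).2
        have := Real.exp_pos (-u)
        nlinarith
      exact h.trans this
    · intro hu
      have h := ((hbd N).2 u hu).le
      have : c * qUpper κ β u ≤ c * Hp u := by
        refine mul_le_mul_of_nonneg_left ?_ hc.le
        simp only [hHp]
        have := (hpos u).1
        have := Real.exp_pos (-u)
        nlinarith
      exact h.trans this
  · intro s
    simp only [hHp, hHm]
    exact ⟨by linarith [mul_pos hC₁0 (hpos s).1], by linarith [mul_pos hC₁0 (hpos s).2]⟩

end BetaSieve

end Literature.NumberTheory.Sieve
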